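import Summits.CriticalPhenomena.PercolationContinuityZ3.Theorems.PercNearOneGluingNoHeavyLowerTailAntipodalR1PocketGrade
import HarnessLib

/-!
# The pocket flip, III: the graded injection and the reduction of ANTI₁-GRADED to the multiply attached residue

Support file for `stmt-CriticalPhenomena-4575` (memo `prim-gen-kcluster/KCLUSTER-gen79.md` §1; conjecture
ANTI₁-GRADED of `KCLUSTER-gen52.md` §3, whose per-level form on irreducible instances is the hypothesis `Hirr`
of `AntipodalR1.card_lSet_grade_le_of_irreducible`).  No definitions, no named facts, no sorries.
Continuation of `…AntipodalR1PocketFlip` (I) and `…AntipodalR1PocketGrade` (II).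

Call `x ∈ L` **singly attached (at `c`)** if every vertex outside the pocket `Q = region ends x a c` that is
adjacent to `Q` is joined to `a` by an open path of `x` avoiding `Q`; and call `y ∈ R(b,c)` **singly attached**
if, with `S = region ends ȳ a c` the component of `c` in the support graph minus `O_a(y)`, every vertex outside
`S` adjacent to `S` is joined to `a` by a CLOSED path of `y` avoiding `S`.  (Memo notation: `r(x) = 1`,
`r'(y) = 1`.)

* `AntipodalR1.pocketFlip_attached`: the pocket flip of a singly attached `x ∈ L` is a singly attached
  element of `R(b,c)` (with the same pocket: part I's `pocket_eq_region_flip`).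
* `AntipodalR1.card_lSet_attached_grade_le`: **for every level `t`,
  `#{x ∈ L : x singly attached, g(x) = t} ≤ #{y ∈ R(b,c) : y singly attached, g(y) = t}`** — by the pocket
  flip, which is injective (I), lands in the singly attached part of `R(b,c)` and preserves the grade (II).
  In particular `#{x ∈ L : singly attached, g = t} ≤ #{y ∈ R(b,c) : g = t}`
  (`AntipodalR1.card_lSet_attached_grade_le_rSet`).
* `AntipodalR1.card_lSet_grade_le_of_residual`: **REDUCTION** — if for every level
  `#{x ∈ L : NOT singly attached, g = t} ≤ #{y ∈ R(b,c) : NOT singly attached, g = t}` (the MULTIPLY ATTACHED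
  residue), then ANTI₁-GRADED `#{x ∈ L : g = t} ≤ #{y ∈ R(b,c) : g = t}` holds for every `t`.
Part IV shows the converse (the flip is a bijection between the singly attached parts), so ANTI₁-GRADED is
EQUIVALENT to its multiply attached residue.  [this work]
-/

namespace Summit.CriticalPhenomena.PercolationContinuityZ3.Theorems

namespace AntipodalR1

open Finset Relation SimpleGraph

variable {V ι : Type*}

section Attached

variable {ends : ι → Sym2 V} {x y : ι → Bool} {a b c : V}

open Classical in
/-- Closed paths of `x` from `a` do not touch the pocket, so they are closed paths of the flipped colouring
avoiding the pocket. [this work] -/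
theorem closedPath_avoid_of_mem_clus_false (hc : c ∉ clus ends x false a)
    (hy : ∀ e, y e = if (∃ v, v ∈ ends e ∧ v ∈ region ends x a c) then !x e else x e) {v : V}
    (hv : v ∈ clus ends x false a) :
    ReflTransGen (fun u w => w ∈ nbr ends y false u ∧
      u ∉ region ends x a c ∧ w ∉ region ends x a c) a v := by
  rw [mem_clus] at hv
  induction hv with
  | refl => exact ReflTransGen.refl
  | @tail u w hau huw ih =>
    obtain ⟨e, hxe, he⟩ := huw
    have huQ : u ∉ region ends x a c := fun huQ => not_mem_clus_of_region hc huQ hau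
    have hwQ : w ∉ region ends x a c := fun hwQ =>
      not_mem_clus_of_region hc hwQ (hau.tail ⟨e, hxe, he⟩)
    have hye : y e = false := by rw [pocketFlip_of_not_touch hy (not_touch_of_ends he huQ hwQ), hxe]
    exact ih.tail ⟨⟨e, hye, he⟩, huQ, hwQ⟩

open Classical in
/-- **The pocket flip of a singly attached element is singly attached** (on the `R` side: the pocket of `c`
avoiding `O_a(y)` is the old pocket, and its outside neighbours are joined to `a` by closed paths of `y` avoiding
it). [this work] -/
theorem pocketFlip_attached (hc : c ∉ clus ends x false a)
    (hy : ∀ e, y e = if (∃ v, v ∈ ends e ∧ v ∈ region ends x a c) then !x e else x e)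
    (hatt : ∀ w, w ∉ region ends x a c → (∃ e u, ends e = s(w, u) ∧ u ∈ region ends x a c) →
      ReflTransGen (fun u w => w ∈ nbr ends x true u ∧
        u ∉ region ends x a c ∧ w ∉ region ends x a c) a w) :
    ∀ w, w ∉ region ends (fun i => !y i) a c →
      (∃ e u, ends e = s(w, u) ∧ u ∈ region ends (fun i => !y i) a c) →
      ReflTransGen (fun u w => w ∈ nbr ends y false u ∧
        u ∉ region ends (fun i => !y i) a c ∧ w ∉ region ends (fun i => !y i) a c) a w := by
  rw [← pocket_eq_region_flip hc hy hatt]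
  rintro w hwQ ⟨e, u, he, huQ⟩
  exact closedPath_avoid_of_mem_clus_false hc hy
    (mem_clus_of_adj_pocket hc huQ (by rw [he, Sym2.eq_swap]) hwQ)

end Attached

section Counting

variable [Finite V] [Fintype ι] [DecidableEq ι] (ends : ι → Sym2 V) (a b c : V)

open Classical in
/-- **The graded pocket-flip injection.**  For every level `t`:
`#{x ∈ L : singly attached, g(x) = t} ≤ #{y ∈ R(b,c) : singly attached, g(y) = t}`. [this work] -/
theorem card_lSet_attached_grade_le (t : ℕ) :
    ((lSet ends a b c).filter fun x =>
        (∀ w, w ∉ region ends x a c → (∃ e u, ends e = s(w, u) ∧ u ∈ region ends x a c) →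
          ReflTransGen (fun u w => w ∈ nbr ends x true u ∧
            u ∉ region ends x a c ∧ w ∉ region ends x a c) a w) ∧
        Nat.card (fromEdgeSet {s : Sym2 V | ∃ e, x e = true ∧ ends e = s}).ConnectedComponent +
          Nat.card (fromEdgeSet {s : Sym2 V | ∃ e, x e = false ∧ ends e = s}).ConnectedComponent = t).card ≤
      ((rSet ends a b c).filter fun y =>
        (∀ w, w ∉ region ends (fun i => !y i) a c →
          (∃ e u, ends e = s(w, u) ∧ u ∈ region ends (fun i => !y i) a c) →
          ReflTransGen (fun u w => w ∈ nbr ends y false u ∧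
            u ∉ region ends (fun i => !y i) a c ∧ w ∉ region ends (fun i => !y i) a c) a w) ∧
        Nat.card (fromEdgeSet {s : Sym2 V | ∃ e, y e = true ∧ ends e = s}).ConnectedComponent +
          Nat.card (fromEdgeSet {s : Sym2 V | ∃ e, y e = false ∧ ends e = s}).ConnectedComponent = t).card := by
  refine Finset.card_le_card_of_injOn
    (fun x e => if (∃ v, v ∈ ends e ∧ v ∈ region ends x a c) then !x e else x e) ?_ ?_
  · intro x hx
    rw [Finset.mem_coe, Finset.mem_filter] at hx
    obtain ⟨hxL, hatt, hxg⟩ := hx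
    have hcK : c ∉ clus ends x false a := (mem_lSet.1 hxL).2.2.2.1
    rw [Finset.mem_coe, Finset.mem_filter]
    refine ⟨pocketFlip_mem_rSet hxL (y := fun e => if (∃ v, v ∈ ends e ∧ v ∈ region ends x a c) then !x e else x e)
        (fun _ => rfl) hatt, pocketFlip_attached hcK (fun _ => rfl) hatt, ?_⟩
    rw [← hxg]
    exact grade_pocketFlip hcK (y := fun e => if (∃ v, v ∈ ends e ∧ v ∈ region ends x a c) then !x e else x e)
      (fun _ => rfl) hatt
  · intro x₁ hx₁ x₂ hx₂ h
    rw [Finset.mem_coe, Finset.mem_filter] at hx₁ hx₂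
    exact pocketFlip_injOn (mem_lSet.1 hx₁.1).2.2.2.1 (mem_lSet.1 hx₂.1).2.2.2.1
      (y := fun e => if (∃ v, v ∈ ends e ∧ v ∈ region ends x₁ a c) then !x₁ e else x₁ e)
      (fun _ => rfl) (fun e => by have h' := congrFun h e; dsimp only at h'; exact h') hx₁.2.1 hx₂.2.1

open Classical in
/-- The graded pocket-flip injection into all of `R(b,c)`:
`#{x ∈ L : singly attached, g(x) = t} ≤ #{y ∈ R(b,c) : g(y) = t}`. [this work] -/
theorem card_lSet_attached_grade_le_rSet (t : ℕ) :
    ((lSet ends a b c).filter fun x =>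
        (∀ w, w ∉ region ends x a c → (∃ e u, ends e = s(w, u) ∧ u ∈ region ends x a c) →
          ReflTransGen (fun u w => w ∈ nbr ends x true u ∧
            u ∉ region ends x a c ∧ w ∉ region ends x a c) a w) ∧
        Nat.card (fromEdgeSet {s : Sym2 V | ∃ e, x e = true ∧ ends e = s}).ConnectedComponent +
          Nat.card (fromEdgeSet {s : Sym2 V | ∃ e, x e = false ∧ ends e = s}).ConnectedComponent = t).card ≤
      ((rSet ends a b c).filter fun y =>
        Nat.card (fromEdgeSet {s : Sym2 V | ∃ e, y e = true ∧ ends e = s}).ConnectedComponent +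
          Nat.card (fromEdgeSet {s : Sym2 V | ∃ e, y e = false ∧ ends e = s}).ConnectedComponent = t).card := by
  refine (card_lSet_attached_grade_le ends a b c t).trans (Finset.card_le_card ?_)
  intro y hy
  rw [Finset.mem_filter] at hy ⊢
  exact ⟨hy.1, hy.2.2⟩

open Classical in
/-- **REDUCTION OF ANTI₁-GRADED TO THE MULTIPLY ATTACHED RESIDUE.**  If for every level `t` the elements of
`L` that are NOT singly attached at `c` are at most as many as the elements of `R(b,c)` that are NOT singly
attached, then ANTI₁-GRADED holds: `#{x ∈ L : g(x) = t} ≤ #{y ∈ R(b,c) : g(y) = t}` for every `t`. [this work] -/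
theorem card_lSet_grade_le_of_residual
    (hres : ∀ t : ℕ,
      ((lSet ends a b c).filter fun x =>
        (¬ ∀ w, w ∉ region ends x a c → (∃ e u, ends e = s(w, u) ∧ u ∈ region ends x a c) →
          ReflTransGen (fun u w => w ∈ nbr ends x true u ∧
            u ∉ region ends x a c ∧ w ∉ region ends x a c) a w) ∧
        Nat.card (fromEdgeSet {s : Sym2 V | ∃ e, x e = true ∧ ends e = s}).ConnectedComponent +
          Nat.card (fromEdgeSet {s : Sym2 V | ∃ e, x e = false ∧ ends e = s}).ConnectedComponent = t).card ≤
      ((rSet ends a b c).filter fun y =>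
        (¬ ∀ w, w ∉ region ends (fun i => !y i) a c →
          (∃ e u, ends e = s(w, u) ∧ u ∈ region ends (fun i => !y i) a c) →
          ReflTransGen (fun u w => w ∈ nbr ends y false u ∧
            u ∉ region ends (fun i => !y i) a c ∧ w ∉ region ends (fun i => !y i) a c) a w) ∧
        Nat.card (fromEdgeSet {s : Sym2 V | ∃ e, y e = true ∧ ends e = s}).ConnectedComponent +
          Nat.card (fromEdgeSet {s : Sym2 V | ∃ e, y e = false ∧ ends e = s}).ConnectedComponent = t).card)
    (t : ℕ) :
    ((lSet ends a b c).filter fun x =>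
        Nat.card (fromEdgeSet {s : Sym2 V | ∃ e, x e = true ∧ ends e = s}).ConnectedComponent +
          Nat.card (fromEdgeSet {s : Sym2 V | ∃ e, x e = false ∧ ends e = s}).ConnectedComponent = t).card ≤
      ((rSet ends a b c).filter fun y =>
        Nat.card (fromEdgeSet {s : Sym2 V | ∃ e, y e = true ∧ ends e = s}).ConnectedComponent +
          Nat.card (fromEdgeSet {s : Sym2 V | ∃ e, y e = false ∧ ends e = s}).ConnectedComponent = t).card := by
  -- split both level sets into the singly attached part and the rest
  have h1 := card_lSet_attached_grade_le ends a b c t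
  have h2 := hres t
  have splitL := Finset.card_filter_add_card_filter_not
    (s := (lSet ends a b c).filter fun x =>
      Nat.card (fromEdgeSet {s : Sym2 V | ∃ e, x e = true ∧ ends e = s}).ConnectedComponent +
        Nat.card (fromEdgeSet {s : Sym2 V | ∃ e, x e = false ∧ ends e = s}).ConnectedComponent = t)
    (fun x : ι → Bool => ∀ w, w ∉ region ends x a c → (∃ e u, ends e = s(w, u) ∧ u ∈ region ends x a c) →
      ReflTransGen (fun u w => w ∈ nbr ends x true u ∧
        u ∉ region ends x a c ∧ w ∉ region ends x a c) a w)
  have splitR := Finset.card_filter_add_card_filter_not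
    (s := (rSet ends a b c).filter fun y =>
      Nat.card (fromEdgeSet {s : Sym2 V | ∃ e, y e = true ∧ ends e = s}).ConnectedComponent +
        Nat.card (fromEdgeSet {s : Sym2 V | ∃ e, y e = false ∧ ends e = s}).ConnectedComponent = t)
    (fun y : ι → Bool => ∀ w, w ∉ region ends (fun i => !y i) a c →
      (∃ e u, ends e = s(w, u) ∧ u ∈ region ends (fun i => !y i) a c) →
      ReflTransGen (fun u w => w ∈ nbr ends y false u ∧
        u ∉ region ends (fun i => !y i) a c ∧ w ∉ region ends (fun i => !y i) a c) a w)
  rw [Finset.filter_filter, Finset.filter_filter] at splitL splitR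
  have eL1 : ((lSet ends a b c).filter fun x =>
      (Nat.card (fromEdgeSet {s : Sym2 V | ∃ e, x e = true ∧ ends e = s}).ConnectedComponent +
        Nat.card (fromEdgeSet {s : Sym2 V | ∃ e, x e = false ∧ ends e = s}).ConnectedComponent = t) ∧
      (∀ w, w ∉ region ends x a c → (∃ e u, ends e = s(w, u) ∧ u ∈ region ends x a c) →
        ReflTransGen (fun u w => w ∈ nbr ends x true u ∧
          u ∉ region ends x a c ∧ w ∉ region ends x a c) a w)).card =
      ((lSet ends a b c).filter fun x =>
        (∀ w, w ∉ region ends x a c → (∃ e u, ends e = s(w, u) ∧ u ∈ region ends x a c) →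
          ReflTransGen (fun u w => w ∈ nbr ends x true u ∧
            u ∉ region ends x a c ∧ w ∉ region ends x a c) a w) ∧
        Nat.card (fromEdgeSet {s : Sym2 V | ∃ e, x e = true ∧ ends e = s}).ConnectedComponent +
          Nat.card (fromEdgeSet {s : Sym2 V | ∃ e, x e = false ∧ ends e = s}).ConnectedComponent = t).card := by
    congr 1; exact Finset.filter_congr fun x _ => and_comm
  have eL2 : ((lSet ends a b c).filter fun x =>
      (Nat.card (fromEdgeSet {s : Sym2 V | ∃ e, x e = true ∧ ends e = s}).ConnectedComponent +
        Nat.card (fromEdgeSet {s : Sym2 V | ∃ e, x e = false ∧ ends e = s}).ConnectedComponent = t) ∧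
      ¬ (∀ w, w ∉ region ends x a c → (∃ e u, ends e = s(w, u) ∧ u ∈ region ends x a c) →
        ReflTransGen (fun u w => w ∈ nbr ends x true u ∧
          u ∉ region ends x a c ∧ w ∉ region ends x a c) a w)).card =
      ((lSet ends a b c).filter fun x =>
        (¬ ∀ w, w ∉ region ends x a c → (∃ e u, ends e = s(w, u) ∧ u ∈ region ends x a c) →
          ReflTransGen (fun u w => w ∈ nbr ends x true u ∧
            u ∉ region ends x a c ∧ w ∉ region ends x a c) a w) ∧
        Nat.card (fromEdgeSet {s : Sym2 V | ∃ e, x e = true ∧ ends e = s}).ConnectedComponent +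
          Nat.card (fromEdgeSet {s : Sym2 V | ∃ e, x e = false ∧ ends e = s}).ConnectedComponent = t).card := by
    congr 1; exact Finset.filter_congr fun x _ => and_comm
  have eR1 : ((rSet ends a b c).filter fun y =>
      (Nat.card (fromEdgeSet {s : Sym2 V | ∃ e, y e = true ∧ ends e = s}).ConnectedComponent +
        Nat.card (fromEdgeSet {s : Sym2 V | ∃ e, y e = false ∧ ends e = s}).ConnectedComponent = t) ∧
      (∀ w, w ∉ region ends (fun i => !y i) a c →
        (∃ e u, ends e = s(w, u) ∧ u ∈ region ends (fun i => !y i) a c) →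
        ReflTransGen (fun u w => w ∈ nbr ends y false u ∧
          u ∉ region ends (fun i => !y i) a c ∧ w ∉ region ends (fun i => !y i) a c) a w)).card =
      ((rSet ends a b c).filter fun y =>
        (∀ w, w ∉ region ends (fun i => !y i) a c →
          (∃ e u, ends e = s(w, u) ∧ u ∈ region ends (fun i => !y i) a c) →
          ReflTransGen (fun u w => w ∈ nbr ends y false u ∧
            u ∉ region ends (fun i => !y i) a c ∧ w ∉ region ends (fun i => !y i) a c) a w) ∧
        Nat.card (fromEdgeSet {s : Sym2 V | ∃ e, y e = true ∧ ends e = s}).ConnectedComponent +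
          Nat.card (fromEdgeSet {s : Sym2 V | ∃ e, y e = false ∧ ends e = s}).ConnectedComponent = t).card := by
    congr 1; exact Finset.filter_congr fun x _ => and_comm
  have eR2 : ((rSet ends a b c).filter fun y =>
      (Nat.card (fromEdgeSet {s : Sym2 V | ∃ e, y e = true ∧ ends e = s}).ConnectedComponent +
        Nat.card (fromEdgeSet {s : Sym2 V | ∃ e, y e = false ∧ ends e = s}).ConnectedComponent = t) ∧
      ¬ (∀ w, w ∉ region ends (fun i => !y i) a c →
        (∃ e u, ends e = s(w, u) ∧ u ∈ region ends (fun i => !y i) a c) →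
        ReflTransGen (fun u w => w ∈ nbr ends y false u ∧
          u ∉ region ends (fun i => !y i) a c ∧ w ∉ region ends (fun i => !y i) a c) a w)).card =
      ((rSet ends a b c).filter fun y =>
        (¬ ∀ w, w ∉ region ends (fun i => !y i) a c →
          (∃ e u, ends e = s(w, u) ∧ u ∈ region ends (fun i => !y i) a c) →
          ReflTransGen (fun u w => w ∈ nbr ends y false u ∧
            u ∉ region ends (fun i => !y i) a c ∧ w ∉ region ends (fun i => !y i) a c) a w) ∧
        Nat.card (fromEdgeSet {s : Sym2 V | ∃ e, y e = true ∧ ends e = s}).ConnectedComponent +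
          Nat.card (fromEdgeSet {s : Sym2 V | ∃ e, y e = false ∧ ends e = s}).ConnectedComponent = t).card := by
    congr 1; exact Finset.filter_congr fun x _ => and_comm
  rw [eL1, eL2] at splitL
  rw [eR1, eR2] at splitR
  omega

end Counting

end AntipodalR1

end Summit.CriticalPhenomena.PercolationContinuityZ3.Theorems
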